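import Summits.CriticalPhenomena.PercolationContinuityZ3.Theorems.PercNearOneGluingNoHeavyQuantVolumeTailWindowRigidity
import Summits.CriticalPhenomena.PercolationContinuityZ3.Theorems.PercNearOneGluingNoHeavyQuantVolumeTailWindowFree
import Literature.Probability.Percolation.HutchcroftVolumeTailSubcritical
import HarnessLib

/-!
# THE PARABOLIC NEAR-CRITICAL WINDOW IS MAXIMAL: beyond `k·(p − p_c)² ≳ 1` the critical shape of `P_p(|C| ≥ k)` is lost on BOTH sides —
# above `p_c` by the mean-field lower bound `P_{p_c+s}(|C| ≥ k) ≥ θ(p_c+s) ≥ s` (every `d ≥ 2`, no hypothesis), below `p_c` by Hutchcroft's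
# exponential decay `P_{p_c−s}(|C| ≥ k) ≤ C₁e²k^{−1/δ}exp(−c·s·k^{1/δ})`; in high dimensions (triangle condition, `δ = 2`) the two
# thresholds and the window of `…QuantVolumeTailWindowRigidity` are all `k·s² ≍ 1` — UNCONDITIONALLY for every `d ≥ D`
# — quant lane, METHOD = differential inequalities near `p_c`, seat p4 gen 37, file 9

builds on p205010 (kernel theorem, internal audit signed; external expert review pending).  (Nothing in THIS file uses p205010.)

Seat `prim-quant-p4`, `--supports stmt-CriticalPhenomena-4575`; pure proofs, no definitions (`local notation3` only).
Notation: `A[k, q] = P_{PR q}(|C(0)| ≥ k)`, `PC = p_c`, `a_k = P_{p_c}(|C| ≥ k)`.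

THE POINT.  Files 1, 3, 4 give the RIGIDITY window: under `c₁k^{−1/δ} ≤ a_k ≤ C₁k^{−1/δ}`, `(c₁/2)k^{−1/δ} ≤ P_p(|C| ≥ k) ≤ 4C₁k^{−1/δ}` for
`|p − p_c| ≤ s`, `k·s² ≤ L`.  This file records that the window cannot be widened (up to constants, in mean field):
* §1 (every `d ≥ 2`, NO hypothesis) **`P_{p_c+s}(|C| ≥ k) ≥ s`** for `0 ≤ s ≤ 1 − p_c` (`≥ θ(p_c+s) ≥ s`, Aizenman–Barsky /
  Duminil-Copin–Tassion, tree `sub_criticalProb_le_theta`); hence the upper envelope `E` of ANY window theorem fails as soon as `s > E`: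
  with `E = 4C₁k^{−1/2}` this is `k·s² > 16C₁²` — the supercritical edge of the parabolic window;
* §2 (typed tails) **`P_{p_c−s}(|C| ≥ k) ≤ (C₁e²)k^{−1/δ}·exp(−(2(1−e⁻¹)(1−1/δ)/C₁)·s·k^{1/δ})`** (Hutchcroft 2020 Thm 1.1, tree
  `GhostExploration.real_clusterSizeGe_subcritical_le`), so the lower envelope `(c₁/2)k^{−1/δ}` fails once
  `s·k^{1/δ} ≥ (C₁/(2(1−e⁻¹)(1−1/δ)))·log(4C₁e²/c₁)`; for `δ = 2` this is `k·s² ≳ 1` — the subcritical edge;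
* §3 **MEAN FIELD / TRIANGLE CONDITION: the window is `k·s² ≍ 1` on both sides, sharp up to constants** — there are `0 < c ≤ C`, `0 < L ≤ M`,
  `s₀ > 0` with `c k^{−1/2} ≤ P_p(|C| ≥ k) ≤ Ck^{−1/2}` whenever `k s² ≤ L`, `|p−p_c| ≤ s ≤ s₀`, and `P_{p_c+s}(|C| ≥ k) > Ck^{−1/2}`,
  `P_{p_c−s}(|C| ≥ k) < ck^{−1/2}` whenever `k s² ≥ M`, `0 < s ≤ s₀` (`volTail_window_sharp_of_triangle`); UNCONDITIONAL for all `d ≥ D`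
  (`volTail_window_sharp_high_dim`).  For `3 ≤ d ≤ 6` (`δ > 2` expected) §1/§2 leave the gap `k^{−1/2} ≲ s ≲ k^{−1/δ}` where the true
  crossover `s ≍ k^{−1/(βδ)}` lives (gap exponent `Δ = βδ > 2` there).

HONEST STATUS.  NEW AS TYPED, ELEMENTARY packaging of printed, tree-proved results (AB87/DCT16 mean-field bound; Hutchcroft 2020 Thm. 1.1;
files 1–4 of this generation; `δ = 2` under the triangle condition, Hara–Slade).  NO rate, NO exponent value for `d = 3`; (T1)/(T2) and the
lane's honest sentence UNCHANGED.

## References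
* M. Aizenman, D. J. Barsky, Comm. Math. Phys. 108 (1987), Thm. 1.2 [AizenmanBarsky1987]; H. Duminil-Copin, V. Tassion, Enseign.
  Math. 62 (2016), Thm. 1.1(2) [DuminilCopinTassionEM2016].
* T. Hutchcroft, Probab. Math. Phys. 1 (2020) 147–165, Thm. 1.1 [Hutchcroft2020].
* R. Fitzner, R. van der Hofstad, Electron. J. Probab. 22 (2017), (1.6)–(1.8) [FitznerVanDerHofstad2017]; T. Hara, G. Slade,
  Comm. Math. Phys. 128 (1990), Thm. 1.1 [HaraSlade1990].
-/

noncomputable section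

namespace Summit.CriticalPhenomena.PercolationContinuityZ3.Theorems

open MeasureTheory Finset Literature.Probability.Percolation Literature.Probability.LatticeModels
open Literature.Probability.Percolation.GhostExploration Literature.Probability.FitznerVanDerHofstad2017
open Literature.Barriers.CriticalPhenomena
open scoped Classical

namespace VolOS

variable {d : ℕ}

local notation3 "PR[" q "]" => (Set.projIcc (0 : ℝ) 1 zero_le_one q)
local notation3 "A[" k ", " q "]" => (bondPercolation (zdGraph d) (Set.projIcc (0 : ℝ) 1 zero_le_one q)).real (clusterSizeGe (0 : Site d) (k : ℕ))
local notation3 "PC" => ((criticalProbI d : unitInterval) : ℝ)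

/-! ### §1. Above `p_c` the tail is at least `s` (no hypothesis): the supercritical edge of the window -/

/-- **`P_{p_c+s}(|C| ≥ k) ≥ s`** for every `k`, `0 ≤ s ≤ 1 − p_c`, `d ≥ 2` (`P_p(|C| ≥ k) ≥ θ(p) ≥ p − p_c`, the Aizenman–Barsky /
Duminil-Copin–Tassion mean-field lower bound, tree `sub_criticalProb_le_theta`).
[cite: AizenmanBarsky1987, Thm. 1.2] [cite: DuminilCopinTassionEM2016, Thm. 1.1(2)] -/
theorem le_volTail_supercrit (hd : 2 ≤ d) (k : ℕ) {s : ℝ} (hs0 : 0 ≤ s) (hs1 : s ≤ 1 - PC) : s ≤ A[k, PC + s] := by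
  have hpc0 : 0 < PC := ChiF.criticalProbI_pos hd
  have hqq : ((PR[PC + s] : unitInterval) : ℝ) = PC + s := by
    rw [Set.projIcc_of_mem _ ⟨by linarith, by linarith⟩]
  have hθ := sub_criticalProb_le_theta hd PR[PC + s] (by rw [hqq, ← coe_criticalProbI]; linarith)
  rw [hqq, ← coe_criticalProbI] at hθ
  have hmono : theta (zdGraph d) 0 PR[PC + s] ≤ A[k, PC + s] :=
    measureReal_mono (percolatesAt_subset_clusterSizeGe (0 : Site d) k)
  linarith

/-- **THE SUPERCRITICAL EDGE**: any upper envelope `E` for `P_{p_c+s}(|C| ≥ k)` fails as soon as `E < s ≤ 1 − p_c`: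
`E < P_{p_c+s}(|C| ≥ k)`.  With `E = 4C₁k^{−1/2}` (the mean-field window bound of `…WindowRigidity`): the bound is violated for
`k·s² > 16C₁²`. [cite: AizenmanBarsky1987, Thm. 1.2] -/
theorem envelope_lt_volTail_supercrit (hd : 2 ≤ d) (k : ℕ) {E s : ℝ} (hEs : E < s) (hs0 : 0 ≤ s) (hs1 : s ≤ 1 - PC) :
    E < A[k, PC + s] :=
  lt_of_lt_of_le hEs (le_volTail_supercrit hd k hs0 hs1)

/-! ### §2. Below `p_c` the tail decays in `s·k^{1/δ}` (typed upper tail): the subcritical edge of the window -/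

/-- **HUTCHCROFT'S SUBCRITICAL DECAY IN THE WINDOW VARIABLE** (`d ≥ 2`, `δ > 1`, `a_j ≤ C₁j^{−1/δ}` for `j ≥ 1`): for `k ≥ 1`, `0 < s < p_c`:
**`P_{p_c−s}(|C| ≥ k) ≤ C₁e²·k^{−1/δ}·exp(−(2(1−e⁻¹)(1−1/δ)/C₁)·s·k^{1/δ})`** (tree `GhostExploration.real_clusterSizeGe_subcritical_le`,
Hutchcroft 2020 Thm. 1.1, here in the `A[k, p_c − s]` form). [cite: Hutchcroft2020, Thm. 1.1] -/
theorem volTail_subcrit_le_exp (hd : 2 ≤ d) {δ C₁ : ℝ} (hδ : 1 < δ)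
    (hUp : ∀ k : ℕ, 1 ≤ k → (bondPercolation (zdGraph d) (criticalProbI d)).real (clusterSizeGe (0 : Site d) k) ≤
      C₁ * (k : ℝ) ^ (-(1 / δ)))
    {k : ℕ} (hk : 1 ≤ k) {s : ℝ} (hs0 : 0 < s) (hs1 : s < PC) :
    A[k, PC - s] ≤ C₁ * Real.exp 2 * (k : ℝ) ^ (-(1 / δ)) *
      Real.exp (-(2 * (1 - Real.exp (-1)) * (1 - 1 / δ) / C₁) * s * (k : ℝ) ^ (1 / δ)) := by
  have hpc1 : PC < 1 := by rw [coe_criticalProbI]; exact criticalProb_zd_lt_one hd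
  have hpp : ((PR[PC - s] : unitInterval) : ℝ) = PC - s := by
    rw [Set.projIcc_of_mem _ ⟨by linarith, by linarith⟩]
  have h := real_clusterSizeGe_subcritical_le (d := d) hδ hUp hk PR[PC - s] (by rw [hpp]; linarith)
  rw [hpp, show PC - (PC - s) = s by ring] at h
  exact h

/-- **THE SUBCRITICAL EDGE** (two-sided typed tail): if moreover `c₁k^{−1/δ} ≤ a_k`, `c₁ > 0`, then for `k ≥ 1` and `0 < s < p_c` with
**`s·k^{1/δ} ≥ (C₁/(2(1−e⁻¹)(1−1/δ)))·log(4C₁e²/c₁)`: `P_{p_c−s}(|C| ≥ k) ≤ (c₁/4)k^{−1/δ} < (c₁/2)k^{−1/δ}`** — the lower envelope of the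
rigidity window fails.  [cite: Hutchcroft2020, Thm. 1.1] -/
theorem volTail_subcrit_lt_envelope (hd : 2 ≤ d) {δ c₁ C₁ : ℝ} (hδ : 1 < δ) (hc₁ : 0 < c₁)
    (hLo : ∀ k : ℕ, 1 ≤ k → c₁ * (k : ℝ) ^ (-(1 / δ)) ≤ (bondPercolation (zdGraph d) (criticalProbI d)).real (clusterSizeGe (0 : Site d) k))
    (hUp : ∀ k : ℕ, 1 ≤ k → (bondPercolation (zdGraph d) (criticalProbI d)).real (clusterSizeGe (0 : Site d) k) ≤
      C₁ * (k : ℝ) ^ (-(1 / δ)))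
    {k : ℕ} (hk : 1 ≤ k) {s : ℝ} (hs0 : 0 < s) (hs1 : s < PC)
    (hsk : C₁ / (2 * (1 - Real.exp (-1)) * (1 - 1 / δ)) * Real.log (4 * C₁ * Real.exp 2 / c₁) ≤ s * (k : ℝ) ^ (1 / δ)) :
    A[k, PC - s] ≤ c₁ / 4 * (k : ℝ) ^ (-(1 / δ)) ∧ A[k, PC - s] < c₁ / 2 * (k : ℝ) ^ (-(1 / δ)) := by
  have hk0 : (0 : ℝ) < k := by exact_mod_cast hk
  have hkpow : 0 < (k : ℝ) ^ (-(1 / δ)) := Real.rpow_pos_of_pos hk0 _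
  have hC0 : 0 < C₁ := by
    have h : 0 < C₁ * (k : ℝ) ^ (-(1 / δ)) := (mul_pos hc₁ hkpow).trans_le ((hLo k hk).trans (hUp k hk))
    exact (mul_pos_iff_of_pos_right hkpow).mp h
  have hcC : c₁ ≤ C₁ := le_of_mul_le_mul_right ((hLo 1 le_rfl).trans (hUp 1 le_rfl)) (Real.rpow_pos_of_pos (Nat.cast_pos.2 one_pos) _)
  have hδ0 : 0 < δ := by linarith
  have h1δ : 0 < 1 - 1 / δ := by
    have : 1 / δ < 1 := by rw [div_lt_one hδ0]; exact hδ
    linarith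
  have he : 0 < 1 - Real.exp (-1) := by linarith [Real.exp_lt_one_iff.2 (show (-1 : ℝ) < 0 by norm_num)]
  set κ : ℝ := 2 * (1 - Real.exp (-1)) * (1 - 1 / δ) / C₁ with hκ
  have hκ0 : 0 < κ := by positivity
  -- the exponent is at most `−log(4C₁e²/c₁)`
  have harg : 1 < 4 * C₁ * Real.exp 2 / c₁ := by
    rw [lt_div_iff₀ hc₁]
    have he2 : 1 < Real.exp 2 := Real.one_lt_exp_iff.2 (by norm_num)
    nlinarith
  have hlog0 : 0 < Real.log (4 * C₁ * Real.exp 2 / c₁) := Real.log_pos harg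
  have hexp : Real.exp (-κ * s * (k : ℝ) ^ (1 / δ)) ≤ c₁ / (4 * C₁ * Real.exp 2) := by
    have h1 : Real.log (4 * C₁ * Real.exp 2 / c₁) ≤ κ * (s * (k : ℝ) ^ (1 / δ)) := by
      have h2 : C₁ / (2 * (1 - Real.exp (-1)) * (1 - 1 / δ)) = 1 / κ := by
        rw [hκ]; field_simp
      rw [h2, one_div, ← div_eq_inv_mul, div_le_iff₀ hκ0] at hsk
      linarith
    calc Real.exp (-κ * s * (k : ℝ) ^ (1 / δ)) = Real.exp (-(κ * (s * (k : ℝ) ^ (1 / δ)))) := by ring_nf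
      _ ≤ Real.exp (-Real.log (4 * C₁ * Real.exp 2 / c₁)) := Real.exp_le_exp.2 (by linarith)
      _ = c₁ / (4 * C₁ * Real.exp 2) := by
          rw [Real.exp_neg, Real.exp_log (by positivity), inv_div]
  have hmain : A[k, PC - s] ≤ c₁ / 4 * (k : ℝ) ^ (-(1 / δ)) := by
    calc A[k, PC - s] ≤ C₁ * Real.exp 2 * (k : ℝ) ^ (-(1 / δ)) * Real.exp (-κ * s * (k : ℝ) ^ (1 / δ)) :=
          volTail_subcrit_le_exp hd hδ hUp hk hs0 hs1
      _ ≤ C₁ * Real.exp 2 * (k : ℝ) ^ (-(1 / δ)) * (c₁ / (4 * C₁ * Real.exp 2)) := by gcongr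
      _ = c₁ / 4 * (k : ℝ) ^ (-(1 / δ)) := by field_simp
  exact ⟨hmain, lt_of_le_of_lt hmain (by nlinarith [mul_pos hc₁ hkpow])⟩

/-! ### §3. Mean field: the window `k·s² ≍ 1` is sharp on both sides (triangle condition; all `d ≥ D`) -/

/-- **UNDER THE TRIANGLE CONDITION THE PARABOLIC WINDOW IS SHARP ON BOTH SIDES** (`d ≥ 2`): there are `0 < c ≤ C`, `0 < L ≤ M` and `s₀ > 0`
such that (inside) `c·k^{−1/2} ≤ P_p(|C| ≥ k) ≤ C·k^{−1/2}` for all `k ≥ 1`, `0 < s ≤ s₀`, `k·s² ≤ L`, `|p − p_c| ≤ s`, while (outside)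
`P_{p_c+s}(|C| ≥ k) > C·k^{−1/2}` and `P_{p_c−s}(|C| ≥ k) < c·k^{−1/2}` for all `k ≥ 1`, `0 < s ≤ s₀` with `k·s² ≥ M` (`δ = 2` in the
bounded-ratio sense, `meanField_of_triangle`; inside = `volTail_window_two_sided`; outside = §1 with `s ≥ √M·k^{−1/2} > Ck^{−1/2}` and §2).
[cite: FitznerVanDerHofstad2017, Thm. 1.2 / (1.8)] [cite: Hutchcroft2020, Thm. 1.1] [cite: AizenmanBarsky1987, Thm. 1.2] -/
theorem volTail_window_sharp_of_triangle (hd : 2 ≤ d) (hT : TriangleCondition d) :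
    ∃ c C L M s₀ : ℝ, 0 < c ∧ c ≤ C ∧ 0 < L ∧ L ≤ M ∧ 0 < s₀ ∧
      (∀ s : ℝ, 0 < s → s ≤ s₀ → ∀ k : ℕ, 1 ≤ k → (k : ℝ) * s ^ 2 ≤ L →
        ∀ p ∈ Set.Icc (PC - s) (PC + s), c * (k : ℝ) ^ (-(1 / (2 : ℝ))) ≤ A[k, p] ∧ A[k, p] ≤ C * (k : ℝ) ^ (-(1 / (2 : ℝ)))) ∧
      (∀ s : ℝ, 0 < s → s ≤ s₀ → ∀ k : ℕ, 1 ≤ k → M ≤ (k : ℝ) * s ^ 2 →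
        C * (k : ℝ) ^ (-(1 / (2 : ℝ))) < A[k, PC + s] ∧ A[k, PC - s] < c * (k : ℝ) ^ (-(1 / (2 : ℝ)))) := by
  have hpc : PC ∈ Set.Ioo (0 : ℝ) 1 :=
    ⟨ChiF.criticalProbI_pos hd, by rw [coe_criticalProbI]; exact criticalProb_zd_lt_one hd⟩
  have hd0 : (0 : ℝ) < d := by exact_mod_cast (show 0 < d by omega)
  have hMF := (meanField_of_triangle hd hT).2.2.2
  obtain ⟨C₁, hC0, hUp⟩ := upper_tail_of_deltaEqTwo hMF
  obtain ⟨c₁, hc0, hLo⟩ := lower_tail_of_deltaEqTwo hMF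
  have hcC : c₁ ≤ C₁ := le_of_mul_le_mul_right ((hLo 1 le_rfl).trans (hUp 1 le_rfl)) (Real.rpow_pos_of_pos (Nat.cast_pos.2 one_pos) _)
  have hP0 : 0 < 1 - PC := by linarith [hpc.2]
  have hP20 : 0 < PC * (1 - PC) := mul_pos hpc.1 hP0
  have he : 0 < 1 - Real.exp (-1) := by linarith [Real.exp_lt_one_iff.2 (show (-1 : ℝ) < 0 by norm_num)]
  -- window constants of `volTail_window_two_sided` at `δ = 2`
  set L₁ : ℝ := (1 - 1 / (2 : ℝ)) * (PC * (1 - PC)) / (16 * d) with hL₁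
  set L₂ : ℝ := c₁ * (PC / 2 * (1 - PC)) * (1 - 1 / (2 : ℝ)) / (8 * d * C₁) with hL₂
  have hL₁0 : 0 < L₁ := by
    rw [hL₁]; exact div_pos (mul_pos (by norm_num) hP20) (by positivity)
  have hL₂0 : 0 < L₂ := by
    rw [hL₂]; exact div_pos (mul_pos (mul_pos hc0 (mul_pos (half_pos hpc.1) hP0)) (by norm_num)) (by positivity)
  -- thresholds: `√M ≥ 4C₁ + 1` (above) and `√M ≥ T := (C₁/(2(1−e⁻¹)(1/2)))·log(4C₁e²/c₁)` (below)
  set T : ℝ := C₁ / (2 * (1 - Real.exp (-1)) * (1 - 1 / (2 : ℝ))) * Real.log (4 * C₁ * Real.exp 2 / c₁) with hT'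
  have harg : 1 < 4 * C₁ * Real.exp 2 / c₁ := by
    rw [lt_div_iff₀ hc0]
    have he2 : 1 < Real.exp 2 := Real.one_lt_exp_iff.2 (by norm_num)
    nlinarith
  have hT0 : 0 < T := by
    have hlog0 : 0 < Real.log (4 * C₁ * Real.exp 2 / c₁) := Real.log_pos harg
    rw [hT']
    exact mul_pos (div_pos hC0 (mul_pos (mul_pos two_pos he) (by norm_num))) hlog0
  set M : ℝ := max (min L₁ L₂) (max ((4 * C₁ + 1) ^ 2) (T ^ 2)) with hM
  refine ⟨c₁ / 2, 4 * C₁, min L₁ L₂, M, min (PC / 2) ((1 - PC) / 2), by positivity, by linarith, lt_min hL₁0 hL₂0,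
    le_max_left _ _, lt_min (by linarith [hpc.1]) (by linarith), ?_, ?_⟩
  · intro s hs0 hs k hk hks p hp
    exact volTail_window_two_sided hd (δ := 2) (by norm_num) hc0 hLo hUp hs0 (hs.trans (min_le_right _ _))
      (hs.trans (min_le_left _ _)) hk (hks.trans (min_le_left _ _)) (hks.trans (min_le_right _ _)) hp
  · intro s hs0 hs k hk hks
    have hk0 : (0 : ℝ) < k := by exact_mod_cast hk
    have hsk0 : 0 < Real.sqrt k := Real.sqrt_pos.2 hk0
    -- `s·√k ≥ √M`
    have hsq : Real.sqrt M ≤ s * Real.sqrt k := by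
      rw [← Real.sqrt_sq hs0.le, ← Real.sqrt_mul (sq_nonneg s)]
      exact Real.sqrt_le_sqrt (by nlinarith)
    have hM1 : (4 * C₁ + 1) ^ 2 ≤ M := (le_max_left _ _).trans (le_max_right _ _)
    have hM2 : T ^ 2 ≤ M := (le_max_right _ _).trans (le_max_right _ _)
    have hsq1 : 4 * C₁ + 1 ≤ s * Real.sqrt k := by
      calc 4 * C₁ + 1 = Real.sqrt ((4 * C₁ + 1) ^ 2) := (Real.sqrt_sq (by positivity)).symm
        _ ≤ Real.sqrt M := Real.sqrt_le_sqrt hM1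
        _ ≤ s * Real.sqrt k := hsq
    have hsq2 : T ≤ s * Real.sqrt k := by
      calc T = Real.sqrt (T ^ 2) := (Real.sqrt_sq hT0.le).symm
        _ ≤ Real.sqrt M := Real.sqrt_le_sqrt hM2
        _ ≤ s * Real.sqrt k := hsq
    have hrpow : (k : ℝ) ^ (1 / (2 : ℝ)) = Real.sqrt k := (Real.sqrt_eq_rpow (k : ℝ)).symm
    constructor
    · -- above: `4C₁k^{−1/2} < s ≤ A[k, p_c + s]`
      refine envelope_lt_volTail_supercrit hd k ?_ hs0.le (by linarith [hs.trans (min_le_right _ _)])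
      rw [← div_sqrt_eq_mul_rpow hk0, div_lt_iff₀ hsk0]
      linarith
    · -- below: §2 with `s·k^{1/2} ≥ T`
      have h := volTail_subcrit_lt_envelope hd (δ := 2) (by norm_num) hc0 hLo hUp hk hs0
        (by linarith [hs.trans (min_le_left _ _), hpc.1]) (by rw [hrpow]; exact hsq2)
      exact h.2

/-- **IN ALL SUFFICIENTLY HIGH DIMENSIONS THE PARABOLIC NEAR-CRITICAL WINDOW OF `ℤ^d` IS SHARP ON BOTH SIDES**: there is `D > 6` such that
for every `d ≥ D` the conclusion of `volTail_window_sharp_of_triangle` holds (Hara–Slade: the triangle condition holds for `d ≥ D`, tree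
`HaraSlade1990_triangleCondition_holds`).  Standard axioms; unconditional.
[cite: HaraSlade1990, Thm. 1.1] [cite: Hutchcroft2020, Thm. 1.1] [cite: AizenmanBarsky1987, Thm. 1.2] -/
theorem volTail_window_sharp_high_dim :
    ∃ D : ℕ, 6 < D ∧ ∀ d' : ℕ, D ≤ d' → ∃ c C L M s₀ : ℝ, 0 < c ∧ c ≤ C ∧ 0 < L ∧ L ≤ M ∧ 0 < s₀ ∧
      (∀ s : ℝ, 0 < s → s ≤ s₀ → ∀ k : ℕ, 1 ≤ k → (k : ℝ) * s ^ 2 ≤ L →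
        ∀ p ∈ Set.Icc (((criticalProbI d' : unitInterval) : ℝ) - s) (((criticalProbI d' : unitInterval) : ℝ) + s),
          c * (k : ℝ) ^ (-(1 / (2 : ℝ))) ≤
            (bondPercolation (zdGraph d') (Set.projIcc (0 : ℝ) 1 zero_le_one p)).real (clusterSizeGe (0 : Site d') k) ∧
          (bondPercolation (zdGraph d') (Set.projIcc (0 : ℝ) 1 zero_le_one p)).real (clusterSizeGe (0 : Site d') k) ≤
            C * (k : ℝ) ^ (-(1 / (2 : ℝ)))) ∧
      (∀ s : ℝ, 0 < s → s ≤ s₀ → ∀ k : ℕ, 1 ≤ k → M ≤ (k : ℝ) * s ^ 2 →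
        C * (k : ℝ) ^ (-(1 / (2 : ℝ))) <
          (bondPercolation (zdGraph d') (Set.projIcc (0 : ℝ) 1 zero_le_one
            (((criticalProbI d' : unitInterval) : ℝ) + s))).real (clusterSizeGe (0 : Site d') k) ∧
        (bondPercolation (zdGraph d') (Set.projIcc (0 : ℝ) 1 zero_le_one
            (((criticalProbI d' : unitInterval) : ℝ) - s))).real (clusterSizeGe (0 : Site d') k) <
          c * (k : ℝ) ^ (-(1 / (2 : ℝ)))) := by
  obtain ⟨D, hD, hT⟩ := HaraSlade1990_triangleCondition_holds
  exact ⟨D, hD, fun d' hd' => volTail_window_sharp_of_triangle (d := d') (by omega) (hT d' hd')⟩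

end VolOS

end Summit.CriticalPhenomena.PercolationContinuityZ3.Theorems
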